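import Literature.MathematicalPhysics.QuantumLattice.RandomField
import Literature.MathematicalPhysics.QuantumLattice.EuclideanAction
import Literature.MathematicalPhysics.QuantumLattice.SchwartzTensor
import Literature.MathematicalPhysics.QuantumLattice.SchwingerOSAxioms
import HarnessLib

/-!
# Positive-time tensor products of test functions and their totality in `𝒮((ℝ^d)^n₊)`

Topic `Literature/MathematicalPhysics/QuantumLattice` (trunk **T-AQFT**), a support file of the
decomposition of the bridge `Literature.MathematicalPhysics.QuantumLattice.IsOSMeasure.exists_isOSFamily` (measure-form OS axioms ⇒
distributional OS axioms).

Osterwalder–Schrader [OS 1973, §2, pp. 86–87] define the one-point space of test functions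
supported at nonnegative times as a completed tensor product, `𝒮(ℝ⁴₊) := 𝒮(ℝ₊) ⊗̂ 𝒮(ℝ³)`
("i.e. `f ∈ 𝒮(ℝ⁴)` and `supp f ⊂ {x⁰ ≥ 0}`"), and the `n`-point space as
`𝒮(ℝ^{4n}₊) := ⊗̂ₙ 𝒮(ℝ⁴₊)` (p. 87); in other words the finite linear combinations of tensor
products `f₁ ⊗ ⋯ ⊗ fₙ` of nonnegative-time one-point functions are dense, for the Schwartz
topology, in the `n`-point functions supported in the closed wedge `{∀ i, xᵢ⁰ ≥ 0}`. (OS's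
`𝒮₊(ℝ^{4n}) := 𝒮_{0,∞}(ℝ^{4n})`, p. 86, is the smaller TIME-ORDERED space, the tree's
`IsTimeOrdered`; the notation `(ℝ^d)^n₊` of this file always means the unordered wedge.) This
density is what carries reflection positivity from the measure form OS3 (Glimm–Jaffe §6.1,
positivity on the exponentials `∑ cⱼ e^{iφ(fⱼ)}` of (6.1.6), `fⱼ` supported in `{t > 0}`; in the
tree `IsOS3ReflectionPositive`, and its derived polynomial form `OSPolynomialPositivity`) to the
distributional (E2), which the tree (`SchwingerFamily.IsOSReflectionPositive`, following OS (4.2)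
but with unordered supports) states for arbitrary positive-time `n`-point test functions.

This file fixes the vocabulary, for the OPEN-wedge support conditions of `EuclideanAction`
(`IsPositiveTime`: `supp f ⊆ {x⁰ > 0}`; `IsPositiveTimeMulti`: `supp F ⊆ {∀ i, xᵢ⁰ > 0}`), which
are the ones consumed downstream:

* `Literature.AQFT.positiveTensorProducts n`: the set of `n`-point test functions on `(ℝ^d)^n` that
  are tensor products `f₁ ⊗ ⋯ ⊗ fₙ` (witness predicate `IsTensorOf`) of complexified *real*
  one-point test functions `fᵢ ∈ 𝓢(ℝ^d, ℝ)` supported at positive times (`IsPositiveTime`); a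
  subset of the unrestricted `tensorProducts n` of `SchwingerOSAxioms`
  (`positiveTensorProducts_subset_tensorProducts`), whose `ℂ`-span is dense in all of
  `𝓢(((ℝ^d)^n), ℂ)` by the named fact `denseSpan_tensorProducts` there (Reed–Simon I, Thm V.13);
* the named fact `Literature.MathematicalPhysics.QuantumLattice.IsPositiveTimeMulti.mem_closure_span_positiveTensorProducts`, the
  positive-time refinement: every `n`-point test function supported in the open wedge
  (`IsPositiveTimeMulti`) lies in the closure of the `ℂ`-span of `positiveTensorProducts n`;
* the submodule `positiveTimeMultiSubmodule` of positive-time `n`-point functions;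

and proves the elementary facts: positive-time tensor products are positive-time `n`-point
functions (`IsPositiveTimeMulti.of_mem_positiveTensorProducts`), and so is every element of their
span (`isPositiveTimeMulti_of_mem_span`; not of its closure, which only retains the closed
condition `supp ⊆ {∀ i, xᵢ⁰ ≥ 0}`); non-vacuity (`tensorFin_mem_positiveTensorProducts`).

## Sources

* K. Osterwalder, R. Schrader, *Axioms for Euclidean Green's functions*, Comm. Math. Phys. 31
  (1973) 83–112, §2 pp. 86–87 (`𝒮(ℝ⁴₊) = 𝒮(ℝ₊) ⊗̂ 𝒮(ℝ³)`, `𝒮(ℝ^{4n}₊) = ⊗̂ₙ 𝒮(ℝ⁴₊)`, printed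
  with the closed support condition `x⁰ ≥ 0`). [OsterwalderSchraderCMP1973]
* J. Glimm, A. Jaffe, *Quantum Physics: a functional integral point of view*, 2nd ed. (1987),
  §6.1 (OS3 on `𝒜₊`, the span of `e^{iφ(f)}`, `f` positive-time, (6.1.6)). [GlimmJaffeQP1987]
* M. Reed, B. Simon, *Methods of Modern Mathematical Physics I* (1980), Thm V.13 (tensor
  products of Schwartz functions are total; the unrestricted `denseSpan_tensorProducts`).

## Mathlib

Used: `SchwartzMap`, `tsupport`, `Submodule.span`, `closure`. Searched and absent at the pin:
any density statement for tensor products of Schwartz functions (`Dense`/`span` with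
`SchwartzMap`; `hermite` in `Analysis/Distribution`).

## Design

* Real one-point factors (`ofRealTest (f i)`), as in `IsSchwingerFamilyOf`, `tensorProducts` and
  OS3: these are the functions on which the moments of a measure on `𝒮'(ℝ^d)` are given.
* `IsPositiveTime` / `IsPositiveTimeMulti` are the *open* half-space / wedge conditions of
  `EuclideanAction` (`tsupport ⊆ {x⁰ > 0}`); OS print the closed condition `supp ⊆ {x⁰ ≥ 0}`.
  The sharper closed-wedge density (`supp F ⊆ {∀ i, xᵢ⁰ ≥ 0}` ⇒ `F` in the closure of the span of
  tensor products of real `fᵢ` with `supp fᵢ ⊆ {x⁰ ≥ 0}`) is also true and is what OS print; the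
  open form recorded here is the one the consumers (`SchwingerFamily.IsOSReflectionPositive` from
  `IsOS3ReflectionPositive`) need.
-/

open scoped SchwartzMap

noncomputable section

namespace Literature.MathematicalPhysics.QuantumLattice

variable {d : ℕ} [NeZero d] {n : ℕ}

/-- The set of **positive-time tensor products**: `n`-point test functions `F` on `(ℝ^d)^n` of the
form `F(x₁, …, xₙ) = ∏ᵢ fᵢ(xᵢ)` (`IsTensorOf`) with real one-point test functions `fᵢ` supported
at positive times (`IsPositiveTime`, open condition `supp fᵢ ⊆ {x⁰ > 0}`), complexified by
`ofRealTest`. The elementary tensors of OS's `𝒮(ℝ^{dn}₊) = ⊗̂ₙ 𝒮(ℝ^d₊)` (OS 1973 §2, p. 87,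
printed with `supp fᵢ ⊆ {x⁰ ≥ 0}`); a subset of `tensorProducts n` (`SchwingerOSAxioms`). [cite: OsterwalderSchraderCMP1973, §2 pp. 86–87] -/
def positiveTensorProducts (n : ℕ) : Set 𝓢((Fin n → EuclideanSpace ℝ (Fin d)), ℂ) :=
  {F | ∃ f : Fin n → 𝓢(EuclideanSpace ℝ (Fin d), ℝ),
    (∀ i, IsPositiveTime (f i)) ∧ IsTensorOf F fun i => ofRealTest (f i)}

/-- Membership in `positiveTensorProducts`. [folklore] -/
theorem mem_positiveTensorProducts {F : 𝓢((Fin n → EuclideanSpace ℝ (Fin d)), ℂ)} :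
    F ∈ positiveTensorProducts n ↔ ∃ f : Fin n → 𝓢(EuclideanSpace ℝ (Fin d), ℝ),
      (∀ i, IsPositiveTime (f i)) ∧ IsTensorOf F fun i => ofRealTest (f i) :=
  Iff.rfl

/-- Positive-time tensor products are tensor products of real test functions in the sense of
`SchwingerOSAxioms.tensorProducts` (forget the support condition). [folklore] -/
theorem positiveTensorProducts_subset_tensorProducts :
    positiveTensorProducts (d := d) n ⊆ tensorProducts n :=
  fun _ ⟨f, _, hF⟩ => ⟨f, hF⟩

/-- Non-vacuity: the concrete tensor product `tensorFin n (ofRealTest ∘ f)` of positive-time real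
test functions belongs to `positiveTensorProducts n`. [folklore] -/
theorem tensorFin_mem_positiveTensorProducts (f : Fin n → 𝓢(EuclideanSpace ℝ (Fin d), ℝ))
    (hf : ∀ i, IsPositiveTime (f i)) :
    SchwartzMap.tensorFin n (fun i => ofRealTest (f i)) ∈ positiveTensorProducts (d := d) n :=
  ⟨f, hf, isTensorOf_tensorFin _⟩

/-- A tensor product `∏ᵢ fᵢ(xᵢ)` is supported in the product of the supports: if `F` is a tensor
product of the `φᵢ` then `tsupport F ⊆ {x | ∀ i, xᵢ ∈ tsupport φᵢ}`. [folklore] -/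
theorem IsTensorOf.tsupport_subset {E : Type*} [NormedAddCommGroup E] [NormedSpace ℝ E]
    {F : 𝓢((Fin n → E), ℂ)} {φ : Fin n → 𝓢(E, ℂ)} (hF : IsTensorOf F φ) :
    tsupport (F : (Fin n → E) → ℂ) ⊆ {x | ∀ i, x i ∈ tsupport (φ i : E → ℂ)} := by
  have hclosed : IsClosed {x : Fin n → E | ∀ i, x i ∈ tsupport (φ i : E → ℂ)} := by
    simp only [Set.setOf_forall]
    exact isClosed_iInter fun i => (isClosed_tsupport _).preimage (continuous_apply i)
  refine closure_minimal (fun x hx => ?_) hclosed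
  intro i
  by_contra hi
  have h0 : (φ i : E → ℂ) (x i) = 0 := image_eq_zero_of_notMem_tsupport hi
  exact hx (by rw [hF x]; exact Finset.prod_eq_zero (Finset.mem_univ i) h0)

/-- **Positive-time tensor products are positive-time `n`-point functions**: if
`F = f₁ ⊗ ⋯ ⊗ fₙ` with `supp fᵢ ⊆ {x⁰ > 0}` then `supp F ⊆ {∀ i, xᵢ⁰ > 0}` (the open-wedge
analogue of OS 1973 §2, p. 87: `⊗ₙ 𝒮(ℝ⁴₊) ⊆ 𝒮(ℝ^{4n}₊)`). [cite: OsterwalderSchraderCMP1973, §2 p. 87] -/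
theorem IsPositiveTimeMulti.of_mem_positiveTensorProducts
    {F : 𝓢((Fin n → EuclideanSpace ℝ (Fin d)), ℂ)} (hF : F ∈ positiveTensorProducts n) :
    IsPositiveTimeMulti F := by
  obtain ⟨f, hf, hT⟩ := hF
  intro x hx i
  have hi := hT.tsupport_subset hx i
  have hsub : tsupport (ofRealTest (f i) : EuclideanSpace ℝ (Fin d) → ℂ) ⊆
      tsupport (f i : EuclideanSpace ℝ (Fin d) → ℝ) :=
    tsupport_comp_subset (g := fun t : ℝ => (t : ℂ)) Complex.ofReal_zero _
  exact hf i (hsub hi)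

variable (d n) in
/-- The subspace of positive-time `n`-point test functions (`IsPositiveTimeMulti`, support in the
open wedge `{∀ i, xᵢ⁰ > 0}`), the `n`-point analogue of `EuclideanAction.positiveTimeSubmodule`:
supports are stable under sums and scalar multiples. [folklore] -/
def positiveTimeMultiSubmodule : Submodule ℂ 𝓢((Fin n → EuclideanSpace ℝ (Fin d)), ℂ) where
  carrier := {F | IsPositiveTimeMulti F}
  add_mem' {F G} hF hG :=
    (tsupport_add (F : (Fin n → EuclideanSpace ℝ (Fin d)) → ℂ) G).trans (Set.union_subset hF hG)
  zero_mem' := by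
    change tsupport (fun _ : Fin n → EuclideanSpace ℝ (Fin d) => (0 : ℂ)) ⊆ _
    simp
  smul_mem' c F hF :=
    (tsupport_smul_subset_right (fun _ : Fin n → EuclideanSpace ℝ (Fin d) => c)
      (F : (Fin n → EuclideanSpace ℝ (Fin d)) → ℂ)).trans hF

/-- Membership in `positiveTimeMultiSubmodule` is `IsPositiveTimeMulti`. [folklore] -/
@[simp]
theorem mem_positiveTimeMultiSubmodule {F : 𝓢((Fin n → EuclideanSpace ℝ (Fin d)), ℂ)} :
    F ∈ positiveTimeMultiSubmodule d n ↔ IsPositiveTimeMulti F := Iff.rfl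

/-- The `ℂ`-span of the positive-time tensor products is contained in the positive-time
`n`-point functions. [folklore] -/
theorem span_positiveTensorProducts_le :
    Submodule.span ℂ (positiveTensorProducts (d := d) n) ≤ positiveTimeMultiSubmodule d n :=
  Submodule.span_le.2 fun _ hG => IsPositiveTimeMulti.of_mem_positiveTensorProducts hG

/-- Every element of the `ℂ`-span of the positive-time tensor products is a positive-time
`n`-point function. [folklore] -/
theorem isPositiveTimeMulti_of_mem_span {F : 𝓢((Fin n → EuclideanSpace ℝ (Fin d)), ℂ)}
    (hF : F ∈ Submodule.span ℂ (positiveTensorProducts (d := d) n)) : IsPositiveTimeMulti F :=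
  span_positiveTensorProducts_le hF

/-- **Totality of positive-time tensor products in `𝒮((ℝ^d)^n₊)`** (Osterwalder–Schrader 1973,
§2, pp. 86–87: the `n`-point space `𝒮(ℝ^{4n}₊)` *is* the completed tensor product `⊗̂ₙ 𝒮(ℝ⁴₊)`,
and `𝒮(ℝ⁴₊) = 𝒮(ℝ₊) ⊗̂ 𝒮(ℝ³)`, printed for the CLOSED support condition `x⁰ ≥ 0`; the underlying
theorems are the kernel-theorem identifications `𝒮(ℝᵐ) ⊗̂ 𝒮(ℝⁿ) ≅ 𝒮(ℝ^{m+n})` and the density of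
`C_c^∞(X) ⊗ C_c^∞(Y)` in `C_c^∞(X × Y)`). Recorded here in the OPEN-wedge variant used by
`EuclideanAction` / `SchwingerOSAxioms` (a consequence of the same argument, and the form the OS3 ⇒
E2 bridge consumes): every `F ∈ 𝓢(((ℝ^d)^n), ℂ)` with `supp F ⊆ {∀ i, xᵢ⁰ > 0}`
(`IsPositiveTimeMulti F`) lies in the closure, for the Schwartz topology, of the `ℂ`-linear span
of the positive-time tensor products `f₁ ⊗ ⋯ ⊗ fₙ`, `fᵢ ∈ 𝓢(ℝ^d, ℝ)`, `supp fᵢ ⊆ {x⁰ > 0}`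
(`positiveTensorProducts n`). Route of proof: cut `F` off at infinity (`χ_R F → F`, the cut-offs
being compactly supported inside the open wedge), expand in a multiple Fourier series on a period
box inside the wedge and multiply by a product cutoff, and split the characters into real and
imaginary parts. [cite: OsterwalderSchraderCMP1973, §2 pp. 86–87] -/
def IsPositiveTimeMulti.mem_closure_span_positiveTensorProducts : Prop :=
  ∀ (n : ℕ) (F : 𝓢((Fin n → EuclideanSpace ℝ (Fin d)), ℂ)), IsPositiveTimeMulti F →
    F ∈ closure (Submodule.span ℂ (positiveTensorProducts (d := d) n) :
      Set 𝓢((Fin n → EuclideanSpace ℝ (Fin d)), ℂ))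

end Literature.MathematicalPhysics.QuantumLattice
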